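import Summits.HodgeConjecture.HodgeConjecture.Theorems.H413CuspCotPin
import Summits.HodgeConjecture.HodgeConjecture.Theorems.H413TowerConjPin
import Summits.HodgeConjecture.HodgeConjecture.Theorems.P4StubT2cCohClassMapOfHol
import HarnessLib

/-!
# FLOOR-0 P4 — THE MATSUSHIMA–HODGE CLASS MAP AT THE PIN (node T2 = T2a + T2b + T2c, assembled over the three ★ closers)

Cell hodgecm-mathlib (D-0151), FLOOR 0, crux item H413 = stmt-HodgeConjecture-24833; programme P4.  `t2_matsushimaHodgeAt` has for TYPE the node
`StubT2MatsushimaHodgeAt` VERBATIM — the same text in the planner sub-line `Cruxes/H413/Lines/F0_P4AdmissibleOccursInH1.lean` (ed. 1.4, :155) and in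
the PARENT line `Cruxes/H413/Lines/P4AdmissibleOccursInH1.lean` v2.1 (registered hole `stub_T2_matsushimaHodgeAt`, :236): for every face (`3 ≤ n`) and
every `τ'`, an INJECTIVE `U(V)(𝔸_{F⁺,f})`-EQUIVARIANT `ℂ`-linear class map `cls : cohForms (archFactorOf F V) → (datum413 …).HB τ'`.  PROOF = the
sub-line's kernel glue `stubT2_of` run over the three ★ Theorems closers (a `Lines/` module is not importable, so the glue is re-run here, 3 lines):
T2a ★ `CuspCot.t2a_holClassMapAt` (A-p13 (g21), p790124: the holomorphic class map with `(1,0)` range), T2b ★ `TowerConj.towerConjugationAt_pin`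
(A-p19 (g15), p791878: complex conjugation on the tower, Hodge-disjoint from the `(1,0)`-part), T2c ★ `P4StubT2cCohClassMapOfHol.stubT2cCohClassMapOfHol_holds`
(A-p08 (g15), p791720: the generic extension to `hol ⊔ conj hol`).  Purpose: the PARENT line folds its hole by name tonight —
`theorem stub_T2_matsushimaHodgeAt : StubT2MatsushimaHodgeAt := Summit.HodgeConjecture.HodgeConjecture.Cruxes.H413.MatsushimaHodge.t2_matsushimaHodgeAt`
(+ `import Summits.HodgeConjecture.HodgeConjecture.Theorems.H413MatsushimaHodgeClassMap`).  Author A-p19 (g15).  `--supports stmt-HodgeConjecture-24833 --as helper`.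
HC_CM is proved only modulo the 7 printed citations until rung 0 closes; this file proves nothing about them.
[cite: BorelWallach2000, VII 3.2, VII 3.6, XIII 1.2] [cite: VoisinHodgeI2002, Cor. 7.6] [cite: Borel1997, §5.14]

## References
* [BorelWallach2000] A. Borel, N. Wallach, 2nd ed., AMS 2000 — VII 3.2 (Matsushima's formula), VII 3.6 (Hodge types), XIII 1.2 (adelic pieces).
* [VoisinHodgeI2002] C. Voisin, *Hodge Theory and Complex Algebraic Geometry I*, Cor. 7.6.  * [Borel1997] A. Borel, *Automorphic forms on SL₂(ℝ)*, §5.14.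
* Tree: ★ `Theorems/H413CuspCotPin` (`CuspCot.t2a_holClassMapAt`), ★ `Theorems/H413TowerConjPin` (`TowerConj.towerConjugationAt_pin`),
  ★ `Theorems/P4StubT2cCohClassMapOfHol` (`stubT2cCohClassMapOfHol_holds`); the glue is `stubT2_of` of `Lines/F0_P4AdmissibleOccursInH1.lean` §4.
-/

set_option autoImplicit false
set_option linter.dupNamespace false

noncomputable section

open MulAction NumberField NumberField.InfinitePlace
open HodgeCM HodgeCM.Model HodgeCM.Model.LiuIndex HodgeCM.Model.TowerCarrier
open Summit.HodgeConjecture.CorCM.Model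
open Literature.AlgebraicGeometry.Motives (CMType)
open Literature.AlgebraicGeometry.HodgeTheory Literature.NumberTheory.Automorphic.PicardCM
open Literature.AlgebraicGeometry.ShimuraVarieties Literature.AlgebraicGeometry.ShimuraVarieties.UnitaryCanonicalModel
open Literature.NumberTheory.ComplexMultiplication
open Literature.NumberTheory.Automorphic
open Literature.NumberTheory.Automorphic.Liu2021 Literature.NumberTheory.Automorphic.Liu2021.AppendixC
open Literature.NumberTheory.GelbartRogawski1991
open Summit.HodgeConjecture.CorCM Summit.HodgeConjecture.CorCM.Transposition
open Summit.HodgeConjecture.CorCM.Lines.A3Liu413 (datum413)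
open Summit.HodgeConjecture.HodgeConjecture.Cruxes.H413.CohFormsCarriers

namespace Summit.HodgeConjecture.HodgeConjecture.Cruxes.H413.MatsushimaHodge

set_option synthInstance.maxHeartbeats 400000 in
set_option maxHeartbeats 8000000 in
/-- **Node T2 `StubT2MatsushimaHodgeAt`, verbatim: the injective equivariant Matsushima–Hodge class map `cohForms 𝔞₀ → H¹_{B,τ'}(A_∞, ℂ)` AT THE PIN**,
assembled from T2a (holomorphic half, `(1,0)` range), T2b (tower conjugation) and T2c (extension to `hol ⊔ conj hol`).
[cite: BorelWallach2000, VII 3.2, VII 3.6, XIII 1.2] [cite: VoisinHodgeI2002, Cor. 7.6] [cite: Borel1997, §5.14] -/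
theorem t2_matsushimaHodgeAt :
  ∀ (hDel : Literature.AlgebraicGeometry.ShimuraVarieties.UnitaryCanonicalModel.canonicalModel_exists_printed)
      (F : HodgeCM.CMField) [IsGalois ℚ F] (h6 : 6 ≤ Module.finrank ℚ F) {ι₁ : F →+* ℂ} (V : HodgeCM.HermSpace3 F ι₁) (a₀ : RealScalar F)
      (Φ : CMType F) (hΦ : ι₁ ∈ Φ.1) (i : (I V (repAt a₀) (muLiu ι₁ GramClass.rep))),
      3 ≤ (datum413 hDel F V a₀ Φ i).n → ∀ τ' : HodgeCM.CMField.K F →+* ℂ,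
        ∃ cls : ↥(cohForms (archFactorOf F V)) →ₗ[ℂ] (datum413 hDel F V a₀ Φ i).HB τ',
          Function.Injective cls ∧
            ∀ (g : ↥(HodgeCM.HermSpace3.adelicFin V)) (f : ↥(cohForms (archFactorOf F V)))
              (hgf : rightRep F V g (f : _) ∈ cohForms (archFactorOf F V)),
              cls ⟨rightRep F V g (f : _), hgf⟩ = (datum413 hDel F V a₀ Φ i).rhoB τ' g (cls f) := by
  intro hDel F _ h6 ι₁ V a₀ Φ hΦ i hn τ'
  obtain ⟨cls₁₀, hinj, heq, hrange⟩ :=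
    Summit.HodgeConjecture.HodgeConjecture.Cruxes.H413.CuspCot.t2a_holClassMapAt hDel F h6 V a₀ Φ hΦ i hn τ'
  obtain ⟨cB, hcB, hcBeq, hdisj⟩ :=
    Summit.HodgeConjecture.HodgeConjecture.Cruxes.H413.TowerConj.towerConjugationAt_pin hDel F h6 V a₀ Φ hΦ i τ'
  exact Summit.HodgeConjecture.HodgeConjecture.Cruxes.H413.P4StubT2cCohClassMapOfHol.stubT2cCohClassMapOfHol_holds F V
    ((datum413 hDel F V a₀ Φ i).HB τ') ((datum413 hDel F V a₀ Φ i).rhoB τ') _ cls₁₀ hinj heq hrange cB hcB hcBeq hdisj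

end Summit.HodgeConjecture.HodgeConjecture.Cruxes.H413.MatsushimaHodge

end
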